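import Summits.CriticalPhenomena.CardyFormulaZ2.Theses.CardySelfRefinement
import Summits.CriticalPhenomena.CardyFormulaZ2.Theorems.CardySelfRefinementLagHandOffDiscretisableLabelling
import Summits.CriticalPhenomena.CardyFormulaZ2.Theorems.CardySusyWardDiscretisationFamilyExistsAssemblyA
import HarnessLib

/-!
# Every Dobrushin domain is `ℤ²`-discretisable: stub `stub_discretisable` of line `hitting-tournament` for crux `LagHandOff` (stmt-CriticalPhenomena-10268)

`stub_discretisable : ∀ D : DobrushinDomain, ∃ E : ℝ → DiscreteDobrushin, ZdDiscretisationFamily D E`.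

PROOF.  The lattice-topological heart — for every tolerance `η > 0` and all small meshes `δ`, a
labelling `SA ⊔ SB` of the square-lattice boundary `zdBoundary` of the canonical data
`⟨D.carrier, δ, ∅, ∅⟩` by the two Newman sides of a cross-cut built from two legs at the marked
points, with: both labels present, no forcing, `SA` within `η` of `(ab)` and `SB` within `η` of
`(ba)`, exactly two `A`–`B` edges each a side of exactly one inner face, and their midpoints within
`η` of `{a, b}` — is the tree theorem `DiscretisationFamilyExists.eventually_labelling`
(`Theorems/CardySusyWardDiscretisationFamilyExistsAssemblyA.lean` and its `…Exists*` helpers: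
outer boundary loop and its localisation at the marks, legs, cross-cut, sides).  A diagonal choice
of the tolerance `ε δ → 0⁺` (the infimum trick: `ε δ` within `δ` of the infimum of the good
tolerances at mesh `δ`) turns "for every `η`, eventually in `δ`" into the hypotheses of lead-0's
marker-free reduction `zdDiscretisationFamily_of_labelling`
(`Theorems/CardySelfRefinementLagHandOffDiscretisableLabelling.lean`), which produces the family.

The same assembly closes item stmt-CriticalPhenomena-9644 of the sibling route `CardySusyWard`
(`Theorems/CardySusyWardDiscretisationFamilyExists.lean`, `DiscretisationFamilyExists_proof`, whose
statement is the six fields of `ZdDiscretisationFamily` unbundled); it is re-run here (≈ 60 lines,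
the infimum trick inlined) rather than imported, so that the crux's import cone does not acquire
`Theses.CardySusyWard` and `Theses.CardyComplexCone` (that file's cone: +40 `Summits` modules, two
foreign route files).
-/

noncomputable section

open MeasureTheory Filter Set Topology
open scoped unitInterval BoundedContinuousFunction
open Literature.Probability.Percolation Literature.Probability.LatticeModels
open Literature.Probability.RandomPlanarGeometry Literature.Probability.Percolation.QuadCrossing
open Summit.CriticalPhenomena.CardyFormulaZ2.Theorems.DiscretisationFamilyExists
open Summit.CriticalPhenomena.CardyFormulaZ2.Cruxes.LagHandOff.CrosscutDictionary

namespace Summit.CriticalPhenomena.CardyFormulaZ2.Cruxes.LagHandOff.HittingTournament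

-- assembly adapted from Theorems/CardySusyWardDiscretisationFamilyExists.lean
-- (`exists_tendsto_of_forall_eventually`, `DiscretisationFamilyExists_proof`)
/-- **`stub_discretisable`.** Every Dobrushin domain `(D; a, b)` carries an admissible
`ℤ²`-discretisation family with exact domain `(E δ).Ω = D.carrier` and mesh `δ`: the labellings of
`eventually_labelling` at a diagonal tolerance `ε δ → 0⁺` satisfy the hypotheses of the marker-free
reduction `zdDiscretisationFamily_of_labelling`. [folklore] -/
theorem stub_discretisable : ∀ D : DobrushinDomain, ∃ E : ℝ → DiscreteDobrushin, ZdDiscretisationFamily D E := by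
  intro D
  classical
  -- the labelling property at mesh `δ` and tolerance `η`
  set P : ℝ → ℝ → Prop := fun δ η => ∃ SA SB : Set (Site 2),
      (SA ∪ SB = (⟨D.carrier, δ, ∅, ∅⟩ : DiscreteDobrushin).zdBoundary ∧
      Disjoint SA SB ∧ SA.Nonempty ∧ SB.Nonempty ∧
      (∀ y ∈ SA, ¬ Metric.closedBall (meshPoint δ y)
          (Metric.infDist (meshPoint δ y) (frontier D.carrier)) ⊆
        ⋃ x ∈ SB, Metric.closedBall (meshPoint δ x)
          (Metric.infDist (meshPoint δ x) (frontier D.carrier))) ∧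
      (∀ x ∈ SB, ¬ Metric.closedBall (meshPoint δ x)
          (Metric.infDist (meshPoint δ x) (frontier D.carrier)) ⊆
        ⋃ y ∈ SA, Metric.closedBall (meshPoint δ y)
          (Metric.infDist (meshPoint δ y) (frontier D.carrier))) ∧
      (∀ y ∈ SA, Metric.infDist (meshPoint δ y) (D.arc 0) ≤ η) ∧
      (∀ x ∈ SB, Metric.infDist (meshPoint δ x) (D.arc 1) ≤ η) ∧
      {e | e ∈ (discreteDomainGraph D.carrier δ).edgeSet ∧ (∃ x ∈ e, x ∈ SA) ∧
        ∃ y ∈ e, y ∈ SB}.ncard = 2 ∧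
      ∀ e ∈ (discreteDomainGraph D.carrier δ).edgeSet, (∃ x ∈ e, x ∈ SA) → (∃ y ∈ e, y ∈ SB) →
        ∃! f, (⟨D.carrier, δ, ∅, ∅⟩ : DiscreteDobrushin).IsInnerFace f ∧ ∀ x ∈ e, IsCorner x f) ∧
      Metric.hausdorffEDist (medialPoint δ ''
        {e | e ∈ (discreteDomainGraph D.carrier δ).edgeSet ∧ (∃ x ∈ e, x ∈ SA) ∧
          ∃ y ∈ e, y ∈ SB}) {D.pt 0, D.pt 1} ≤ ENNReal.ofReal η with hP
  have hev : ∀ η : ℝ, 0 < η → ∀ᶠ δ in 𝓝[>] (0 : ℝ), P δ η := fun η hη => eventually_labelling D hη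
  -- the infimum trick: a diagonal tolerance `ε δ → 0⁺` with `P δ (ε δ)` eventually
  obtain ⟨ε, hε, hgood⟩ :
      ∃ ε : ℝ → ℝ, Tendsto ε (𝓝[>] 0) (𝓝 0) ∧ ∀ᶠ δ in 𝓝[>] (0 : ℝ), 0 < ε δ ∧ P δ (ε δ) := by
    set G : ℝ → Set ℝ := fun δ => {η | 0 < η ∧ P δ η} with hG
    have hbdd : ∀ δ, BddBelow (G δ) := fun δ => ⟨0, fun η hη => hη.1.le⟩
    set ε : ℝ → ℝ := fun δ =>
      if hx : ∃ η, η ∈ G δ ∧ η < sInf (G δ) + δ then Classical.choose hx else 1 with hεd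
    have hmem : ∀ η : ℝ, 0 < η → ∀ᶠ δ in 𝓝[>] (0 : ℝ), η ∈ G δ := fun η hη =>
      (hev η hη).mono fun δ hδ => ⟨hη, hδ⟩
    have hpos : ∀ᶠ δ in 𝓝[>] (0 : ℝ), 0 < δ := self_mem_nhdsWithin
    -- the choice is made, eventually
    have hchoice : ∀ᶠ δ in 𝓝[>] (0 : ℝ), ε δ ∈ G δ ∧ ε δ < sInf (G δ) + δ := by
      filter_upwards [hmem 1 one_pos, hpos] with δ h1 hδ
      have hx : ∃ η, η ∈ G δ ∧ η < sInf (G δ) + δ := by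
        obtain ⟨η, hη, hlt⟩ := exists_lt_of_csInf_lt ⟨1, h1⟩ (lt_add_of_pos_right _ hδ)
        exact ⟨η, hη, hlt⟩
      have : ε δ = Classical.choose hx := by rw [hεd]; exact dif_pos hx
      rw [this]
      exact Classical.choose_spec hx
    refine ⟨ε, ?_, hchoice.mono fun δ hδ => ⟨hδ.1.1, hδ.1.2⟩⟩
    rw [Metric.tendsto_nhds]
    intro e he
    filter_upwards [hchoice, hmem (e / 2) (by positivity),
      Ioo_mem_nhdsGT (show (0 : ℝ) < e / 2 by positivity)] with δ hc h2 hδ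
    have hinf : sInf (G δ) ≤ e / 2 := csInf_le (hbdd δ) h2
    rw [Real.dist_eq, sub_zero, abs_of_pos hc.1.1]
    linarith [hc.2, hδ.2]
  -- the labels at the diagonal tolerance
  set SA : ℝ → Set (Site 2) := fun δ => if hx : P δ (ε δ) then Classical.choose hx else ∅ with hSA
  set SB : ℝ → Set (Site 2) := fun δ =>
    if hx : P δ (ε δ) then Classical.choose (Classical.choose_spec hx) else ∅ with hSB
  have hspec : ∀ δ (hx : P δ (ε δ)),
      SA δ = Classical.choose hx ∧ SB δ = Classical.choose (Classical.choose_spec hx) :=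
    fun δ hx => ⟨by rw [hSA]; exact dif_pos hx, by rw [hSB]; exact dif_pos hx⟩
  have hlab' : ∀ᶠ δ in 𝓝[>] (0 : ℝ),
      (SA δ ∪ SB δ = (⟨D.carrier, δ, ∅, ∅⟩ : DiscreteDobrushin).zdBoundary ∧
      Disjoint (SA δ) (SB δ) ∧ (SA δ).Nonempty ∧ (SB δ).Nonempty ∧
      (∀ y ∈ SA δ, ¬ Metric.closedBall (meshPoint δ y)
          (Metric.infDist (meshPoint δ y) (frontier D.carrier)) ⊆
        ⋃ x ∈ SB δ, Metric.closedBall (meshPoint δ x)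
          (Metric.infDist (meshPoint δ x) (frontier D.carrier))) ∧
      (∀ x ∈ SB δ, ¬ Metric.closedBall (meshPoint δ x)
          (Metric.infDist (meshPoint δ x) (frontier D.carrier)) ⊆
        ⋃ y ∈ SA δ, Metric.closedBall (meshPoint δ y)
          (Metric.infDist (meshPoint δ y) (frontier D.carrier))) ∧
      (∀ y ∈ SA δ, Metric.infDist (meshPoint δ y) (D.arc 0) ≤ ε δ) ∧
      (∀ x ∈ SB δ, Metric.infDist (meshPoint δ x) (D.arc 1) ≤ ε δ) ∧
      {e | e ∈ (discreteDomainGraph D.carrier δ).edgeSet ∧ (∃ x ∈ e, x ∈ SA δ) ∧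
        ∃ y ∈ e, y ∈ SB δ}.ncard = 2 ∧
      ∀ e ∈ (discreteDomainGraph D.carrier δ).edgeSet, (∃ x ∈ e, x ∈ SA δ) → (∃ y ∈ e, y ∈ SB δ) →
        ∃! f, (⟨D.carrier, δ, ∅, ∅⟩ : DiscreteDobrushin).IsInnerFace f ∧ ∀ x ∈ e, IsCorner x f) ∧
      Metric.hausdorffEDist (medialPoint δ ''
        {e | e ∈ (discreteDomainGraph D.carrier δ).edgeSet ∧ (∃ x ∈ e, x ∈ SA δ) ∧
          ∃ y ∈ e, y ∈ SB δ}) {D.pt 0, D.pt 1} ≤ ENNReal.ofReal (ε δ) := by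
    filter_upwards [hgood] with δ hδ
    obtain ⟨-, hx⟩ := hδ
    obtain ⟨h1, h2⟩ := hspec δ hx
    rw [h1, h2]
    exact Classical.choose_spec (Classical.choose_spec hx)
  -- the discretisation family, by the marker-free reduction
  refine zdDiscretisationFamily_of_labelling D SA SB ε hε (hlab'.mono fun δ hδ => hδ.1) ?_
  have h0 : Tendsto (fun δ : ℝ => ENNReal.ofReal (ε δ)) (𝓝[>] 0) (𝓝 0) := by
    rw [← ENNReal.ofReal_zero]; exact ENNReal.tendsto_ofReal hε
  exact tendsto_of_tendsto_of_tendsto_of_le_of_le' tendsto_const_nhds h0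
    (Eventually.of_forall fun δ => zero_le) (hlab'.mono fun δ hδ => hδ.2)

end Summit.CriticalPhenomena.CardyFormulaZ2.Cruxes.LagHandOff.HittingTournament

end
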